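import Literature.AlgebraicGeometry.Frobenioids.ArchimedeanPointBase
import Literature.AlgebraicGeometry.Frobenioids.Thm36SubInstancesA
import Mathlib.CategoryTheory.Discrete.Basic
import Mathlib.CategoryTheory.Comma.Over.Basic
import HarnessLib

/-!
# Frobenioids II, Theorem 3.6 for THE archimedean Frobenioid `C_v` of [IUTchI] Example 3.4 (i) —
# hypothesis-free instances over the one-morphism base (part A: (i) «istr» clauses, (iv), (v), (vi), (viii))

Mochizuki, *The geometry of Frobenioids II: poly-Frobenioids*, Kyushu J. Math. **62** (2008) 401–460, §3,
Theorem 3.6 pp. 36–38 [cite: MochizukiFrdII2008, Thm 3.6 pp.36-38], at the data of *Inter-universal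
Teichmüller theory I*, Example 3.4 (i), kurims text (May 2020) p. 80: "`C_v` … the archimedean Frobenioid as
in [FrdII], Example 3.3, (ii), where we take the base category to be the one-morphism category determined by
`Spec(K_v)`" [cite: Mochizuki2012, Ex 3.4 (i) p.80] — i.e. `ArchFrd.Cpt = C ptBase` of
`ArchimedeanPointBase.lean` (seat abc-iut-L1-t6), a Frobenioid WITHOUT residual hypothesis
(`ArchFrd.Cpt.isFrobenioid`).

This PROOF-ONLY file (abc-iut cell, L1 row M13 capstone; seat abc-iut-w4-d074) specialises the `Λ`-indexed
instance statements of `ArchimedeanTheoremsInstances.lean` (seat abc-iut-L1-t9), DISCHARGED for every base in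
`Thm36SubInstancesA.lean` (this part) at THE completions `C^ℚ := C^pf`, `C^ℝ := C^rlf`
(`Thm36Sub.pfCompletion`, `Thm36Sub.rlfCompletion`), to the base `ptBase`, where the standing hypothesis
"`C` is a Frobenioid" is a THEOREM — so that Thm. 3.6 (i) [«`(C^Λ)^istr` isotropic + base-trivial»,
«`Λ ≥ ℚ ⇒ (C^Λ)^istr = C^Λ`»], (iv) (first sentence + both repaired readings of the second), (v), (vi),
(viii) hold for `C_v^Λ`, `Λ ∈ {ℤ, ℚ, ℝ}`, with NO hypothesis left; part B (`ArchimedeanPointBaseThm36B.lean`: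
(i) typology, (ix), (x)) waits only for the farm oleans of its inputs.  Moreover the premise of (vi) about the
base ("`D` admits a pseudo-terminal object") is DISCHARGED for the one-morphism base, giving the printed
CONCLUSION outright: every `C_v^Λ` admits a pseudo-terminal object (`cpt_exists_isPseudoTerminal`); the
base lemmas used by part B (slim, strongly indissectible type, complexifiable) are proved here too.  Nothing
is (re)defined; no side is taken on [IUTchIII] Cor. 3.12 (the content is the classical [FrdII] §3).
-/

noncomputable section

namespace Literature.AlgebraicGeometry.Frobenioids

open CategoryTheory

universe v' u'

/-! ### The one-morphism base: pseudo-terminal object, slim, strongly indissectible type, complexifiable -/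

/-- Every object of the one-morphism category is pseudo-terminal ([FrdI] §0).
[cite: MochizukiFrdI2008, §0 p.15] -/
theorem isPseudoTerminal_discretePUnit (A : Discrete PUnit.{1}) : IsPseudoTerminal A := fun B => by
  obtain ⟨⟨⟩⟩ := A
  obtain ⟨⟨⟩⟩ := B
  exact ⟨𝟙 _⟩

/-- The one-morphism category is slim ([FrdI] §0: every `D_A → D` is rigid — all its arrows are identities).
[cite: MochizukiFrdI2008, §0 p.14] -/
theorem isSlim_discretePUnit : IsSlim (Discrete PUnit.{1}) :=
  ⟨fun _ _ => Iso.ext (NatTrans.ext (funext fun _ => Subsingleton.elim _ _))⟩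

/-- The one-morphism category is of strongly indissectible type ([FrdII] §0): its object is initial, so no
family of arrows with NON-INITIAL domains exists. [cite: MochizukiFrdII2008, §0 p.5] -/
theorem isOfStronglyIndissectibleType_discretePUnit :
    IsOfStronglyIndissectibleType (Discrete PUnit.{1}) :=
  ⟨fun A => by
    rintro ⟨X, φ, hne, -⟩
    refine (hne 0).false (Limits.IsInitial.ofUniqueHom (fun Y => eqToHom ?_) fun Y f => ?_)
    · obtain ⟨⟨⟩⟩ := Y
      generalize X 0 = Z
      obtain ⟨⟨⟩⟩ := Z
      rfl
    · exact Subsingleton.elim _ _⟩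

/-- A category over `D₀` all of whose objects are complex is complexifiable ([FrdII] Def. 3.1 (v)) —
vacuously: it has no real objects. [cite: MochizukiFrdII2008, Def 3.1 (v) p.25] -/
theorem RC.isComplexifiable_of_forall_complexObjects {𝓕 : Type u'} [Category.{v'} 𝓕] (P : 𝓕 ⥤ ArchBase)
    (h : ∀ A, complexObjects P A) : IsComplexifiable P :=
  ⟨fun A hA =>
    absurd ((show Module.finrank ℝ (P.obj A) = 1 from hA).symm.trans
      (show Module.finrank ℝ (P.obj A) = 2 from h A)) (by decide)⟩

namespace ArchFrd

namespace Thm36Sub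

/-- The base `Spec ℂ` of [IUTchI] Ex. 3.4 (i), read in `D₀ = ArchBase`, is complexifiable (its one object is
complex). [cite: Mochizuki2012, Ex 3.4 (i) p.80] -/
theorem ptBase_isComplexifiable : RC.IsComplexifiable (baseRC ptBase) :=
  RC.isComplexifiable_of_forall_complexObjects _ fun _ => D0.isComplex_specComplex

/-! ### Theorem 3.6 for `C_v^Λ`, `Λ ∈ {ℤ, ℚ, ℝ}` — no hypothesis -/

/-- **Thm. 3.6 (i)** for `C_v`: "`(C^Λ)^istr` is of isotropic, base-trivial type", all `Λ`.
[cite: MochizukiFrdII2008, Thm 3.6 (i) p.36] -/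
theorem cpt_thm36i_istrTypes :
    Thm36i_istrTypes_C ptBase (pfCompletion ptBase Cpt.isFrobenioid) (rlfCompletion ptBase) :=
  thm36i_istrTypes_C_holds ptBase Cpt.isFrobenioid

/-- **Thm. 3.6 (i)** for `C_v`: "if `Λ ≥ ℚ`, then `(C^Λ)^istr = C^Λ`". [cite: MochizukiFrdII2008, Thm 3.6 (i) p.36] -/
theorem cpt_thm36i_istr_all :
    Thm36i_istr_all_C ptBase (pfCompletion ptBase Cpt.isFrobenioid) (rlfCompletion ptBase) :=
  thm36i_istr_all_C_holds ptBase Cpt.isFrobenioid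

/-- **Thm. 3.6 (iv)**, first sentence, for `C_v^Λ`, all `Λ`. [cite: MochizukiFrdII2008, Thm 3.6 (iv) p.37] -/
theorem cpt_thm36iv : Thm36iv_C ptBase (pfCompletion ptBase Cpt.isFrobenioid) (rlfCompletion ptBase) :=
  thm36iv_C_holds ptBase Cpt.isFrobenioid

/-- **Thm. 3.6 (iv)**, second sentence (both repaired readings), for `C_v^Λ` and `A_v`.
[cite: MochizukiFrdII2008, Thm 3.6 (iv) p.37] -/
theorem cpt_thm36iv_readings :
    Thm36iv_readings_CA ptBase (pfCompletion ptBase Cpt.isFrobenioid) (rlfCompletion ptBase) :=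
  thm36iv_readings_CA_holds ptBase Cpt.isFrobenioid

/-- **Thm. 3.6 (v)** (the groups `O^×(A)`, all clauses) for `C_v^Λ`, all `Λ`. [cite: MochizukiFrdII2008, Thm 3.6 (v) p.37] -/
theorem cpt_thm36v : Thm36v_C ptBase (pfCompletion ptBase Cpt.isFrobenioid) (rlfCompletion ptBase) :=
  thm36v_C_holds ptBase Cpt.isFrobenioid

/-- **Thm. 3.6 (vi)** for `C_v^Λ` and `A_v`. [cite: MochizukiFrdII2008, Thm 3.6 (vi) p.37] -/
theorem cpt_thm36vi : Thm36vi_CA ptBase (pfCompletion ptBase Cpt.isFrobenioid) (rlfCompletion ptBase) :=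
  thm36vi_CA_holds ptBase Cpt.isFrobenioid

/-- **Thm. 3.6 (vi), CONCLUSION for `C_v^Λ`**: every `C_v^Λ` (`Λ ∈ {ℤ, ℚ, ℝ}`) admits a pseudo-terminal object
— the premise "`D` admits a pseudo-terminal object" holds for the one-morphism base.
[cite: MochizukiFrdII2008, Thm 3.6 (vi) p.37] -/
theorem cpt_exists_isPseudoTerminal (Λ : MonoidType) :
    ∃ A : (archFrobenioid ptBase (pfCompletion ptBase Cpt.isFrobenioid) (rlfCompletion ptBase) Λ).cat,
      IsPseudoTerminal A :=
  cpt_thm36vi.1 Λ ⟨⟨PUnit.unit⟩, isPseudoTerminal_discretePUnit _⟩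

/-- **Thm. 3.6 (viii)** for `C_v^Λ` and `A_v`. [cite: MochizukiFrdII2008, Thm 3.6 (viii) p.38] -/
theorem cpt_thm36viii :
    Thm36viii_CA ptBase (pfCompletion ptBase Cpt.isFrobenioid) (rlfCompletion ptBase) :=
  thm36viii_CA_holds' ptBase Cpt.isFrobenioid

end Thm36Sub

end ArchFrd

end Literature.AlgebraicGeometry.Frobenioids

end
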